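import Summits.FinalStateConjecture.FinalStateConjecture.Theorems.PhotonSphereChannelsChannelsResolveTameDevelopmentsRMinkowskiMaximal
import Summits.FinalStateConjecture.FinalStateConjecture.Theorems.ZeroEnergyKerrOrBombStationaryLimitReductionOneDevelopment
import Summits.FinalStateConjecture.FinalStateConjecture.Theorems.PhaseMixingCaptureWeakCosmicCensorshipMGHDCompleteNullInfinityInvariant
import Summits.FinalStateConjecture.FinalStateConjecture.Theorems.EIHFluxBalanceModulatedKerrHandoffStubRaysStayInClosureTransport
import Summits.FinalStateConjecture.FinalStateConjecture.Theorems.EIHFluxBalanceModulatedKerrHandoffStubRayTransport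
import HarnessLib

/-!
# The crux `ChannelsResolveTameDevelopmentsR` (K2R-T2, item `stmt-FinalStateConjecture-17430`) HOLDS ON THE WHOLE
# FIBRE OVER THE TRIVIAL DATUM — every MGHD of `(ℝ³, δ, 0)`, unconditionally
# (route PhotonSphereChannels; anti-vacuity at a certified MGHD, part 2)

Part 1 (`…RMinkowskiMaximal`, `TrivialDatum.settlesT2_minkowski`, `TrivialDatum.cruxHypotheses_minkowski`)
showed that the T2 conclusion of the crux holds at ONE development of the trivial datum, Minkowski space
`Minkowski.vacuumCauchyDevelopment`, which is an MGHD given the Choquet-Bruhat–Geroch existence theorem.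
This file closes the two registered stubs of the item that draw the consequence for EVERY maximal vacuum
Cauchy development `𝒟` of the trivial datum:

* `settlesT2_of_isMaximal` — `𝒟.IsMaximal → SettlesT2 𝒟`, UNCONDITIONALLY: `𝒟` is isometric, as a
  development, to Minkowski space (`Minkowski.isIsometricTo_vacuumCauchyDevelopment_of_isMaximal`:
  Minkowski space is geodesically complete, so its embedding into `𝒟` is onto — Choquet-Bruhat–Geroch 1969,
  Thm. 3; Ringström 2009, Thm. 16.6), and the T2 settle clause is transported along the isometry
  `ψ : ℝ⁴ ≃ 𝒟`: complete `𝓘⁺` is an invariant (`hasCompleteNullInfinity_iff_of_isIsometricTo`), the honest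
  `N = 0` decomposition is pushed forward (`OneLockedExplosion.transportDecomposition`, charts composed with
  `ψ`, `ψ(O) = exteriorOf 𝒟 ψ(charted)` by `image_exteriorOf`), exhaustiveness rides along
  (`hasExhaustiveCharts_transportDecomposition`), rays are transported by the ray correspondence
  (`EIHFluxBalance.TameTemplate.stub_rayTransport` / `stub_raysStayInClosure_transport`), and future
  orientation of the charts by the chain rule and O'Neill's timecone lemma
  (`PreservesTimeOrientation.isFutureDirected_mfderiv`);
* `channelsResolveTameDevelopmentsR_trivialData` (registered stub, seat 0, 2026-08-17T01:01Z) — the BODY of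
  the crux at `X = ℝ³`, `D = trivialData`, for every MGHD (hypotheses complete `𝓘⁺`, (i), (ii) idle);
* `summitProperty_trivialData` (registered stub) — the summit's bundled per-datum property
  `P(trivialData)`: an MGHD exists (Minkowski space, given `choquetBruhat_geroch_exists_mghd_cauchy`) AND every
  MGHD settles in the T2 sense (unconditional).

So on the fibre over the trivial datum the `∀ 𝒟, IsMaximal → …` shape of the crux is not vacuous and is TRUE;
a counterexample to the crux needs a non-flat admissible datum. Only BUILT tree modules are imported (the
general transport `ClusterCompleteness.settlesT2_of_isIsometricTo` lives in a module the farm has not built;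
the transport is re-assembled here from its built constituents, specialised to the Minkowski source).
No `sorry`. References: Choquet-Bruhat–Geroch, CMP 14 (1969), Thm. 3; Ringström, *The Cauchy problem in
General Relativity* (2009), Thm. 16.6; O'Neill, *Semi-Riemannian Geometry* (1983), Ch. 3 pp. 90–91, Ch. 5
p. 145; Christodoulou–Klainerman (1993), Thm. 1.0.2; Dafermos–Luk, arXiv:1710.01722, Conjecture 1.
-/

noncomputable section

-- every `Summit.FinalStateConjecture.FinalStateConjecture.…` name repeats the summit = sub-problem segment (D-0017 layout)
set_option linter.dupNamespace false

open Set Filter Function TopologicalSpace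
open scoped Manifold ContDiff Topology

namespace Summit.FinalStateConjecture.FinalStateConjecture.Theorems.ChannelsResolveTameDevelopmentsR.TrivialDatum

open Literature.Geometry.Lorentzian Literature.Geometry.Lorentzian.Minkowski
open Summit.FinalStateConjecture (HasCompleteNullInfinity exteriorOf RaysStayInClosure HasExhaustiveCharts
  IsFutureOriented)
open Summit.FinalStateConjecture.FinalStateConjecture.Theorems.ClusterCompleteness (SettlesT2)
open Summit.FinalStateConjecture.FinalStateConjecture.Theorems.OneLockedExplosion
  (transportDecomposition charted_transportDecomposition mdifferentiable_diffeomorph image_exteriorOf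
    hasExhaustiveCharts_transportDecomposition)
open Summit.FinalStateConjecture.FinalStateConjecture.Theorems.PhaseMixingCapture.WeakCosmicCensorshipMGHD
  (hasCompleteNullInfinity_iff_of_isIsometricTo)
open Summit.FinalStateConjecture.FinalStateConjecture.Theorems.EIHFluxBalance.TameTemplate
  (stub_raysStayInClosure_transport stub_rayTransport)

/-! ### Future orientation of the charts rides along an isometry -/

/-- **Future orientation of a final-state decomposition is transported along a time-orientation
preserving isometric diffeomorphism `ψ : 𝓢₁ ≃ 𝓢₂`.** The transported decomposition keeps the motions
(so they stay orthochronous) and composes every chart with `ψ`; by the chain rule the push-forward of a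
background's time field under `ψ ∘ Ψ` is `dψ (dΨ V)`, and `dψ` maps future-directed causal vectors to
future-directed causal vectors (O'Neill's timecone lemma). [cite: ONeillSemiRiemannian1983, Ch. 5, p. 145] -/
private theorem isFutureOriented_transport {𝓢₁ 𝓢₂ : Spacetime.{0} 4}
    (ψ : Diffeomorph (𝓡 4) (𝓡 4) 𝓢₁.carrier 𝓢₂.carrier ∞)
    (hiso : 𝓢₁.metric.IsIsometry 𝓢₂.metric.toPseudoRiemannianMetric ψ)
    (hτ : 𝓢₁.timeOrientation.PreservesTimeOrientation ψ 𝓢₂.timeOrientation)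
    {O : Set 𝓢₁.carrier} {k : ℕ} (d : FinalStateDecomposition 𝓢₁ O k) (h : IsFutureOriented d) :
    IsFutureOriented (transportDecomposition ψ hiso hτ d) := by
  -- chain rule + timecone lemma for one chart `Ψ : U → 𝓢₁`
  have step : ∀ {U : Opens E4} {Ψ : U → 𝓢₁.carrier}, ContMDiff 𝓘(ℝ, E4) (𝓡 4) ∞ Ψ →
      ∀ {x : U} {v : E4}, 𝓢₁.timeOrientation.IsFutureDirected (mfderiv 𝓘(ℝ, E4) (𝓡 4) Ψ x v) →
        𝓢₂.timeOrientation.IsFutureDirected (mfderiv 𝓘(ℝ, E4) (𝓡 4) (ψ ∘ Ψ) x v) := by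
    intro U Ψ hΨ x v hv
    have hc : MDifferentiableAt 𝓘(ℝ, E4) (𝓡 4) Ψ x := (hΨ.mdifferentiable (by simp)) x
    rw [mfderiv_comp x (mdifferentiable_diffeomorph ψ _) hc]
    exact hτ.isFutureDirected_mfderiv hiso hv
  obtain ⟨h₁, h₂, h₃⟩ := h
  refine ⟨h₁, fun i ρ ↦ (h₂ i ρ).mono fun τ hτ' x hx ↦ ?_, h₃.mono fun τ hτ' x hx ↦ ?_⟩
  · exact step (d.isLateChart i).contMDiff (hτ' x hx)
  · exact step d.isLateChart_flat.contMDiff (hτ' x hx)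

/-! ### Every MGHD of the trivial datum settles in the T2 sense -/

/-- **EVERY maximal vacuum Cauchy development of the trivial datum `(ℝ³, δ, 0)` settles in the T2 sense**,
unconditionally. Such a development `𝒟` is isometric, as a development, to Minkowski space
(`Minkowski.isIsometricTo_vacuumCauchyDevelopment_of_isMaximal`); Minkowski space settles (T2)
(`settlesT2_minkowski`: complete `𝓘⁺`, honest `N = 0` decomposition of `{x⁰ ≥ 0} = exteriorOf`, rays stay,
charts exhaust, `∂₀ ↦ ∂ₜ`); and each clause is transported along the isometry `ψ`: complete `𝓘⁺`
(`hasCompleteNullInfinity_iff_of_isIsometricTo`), the decomposition (`transportDecomposition`, with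
`ψ(O) = exteriorOf 𝒟 ψ(charted)` by `image_exteriorOf`), `RaysStayInClosure` (ray correspondence
`stub_rayTransport` + `stub_raysStayInClosure_transport`), `HasExhaustiveCharts`
(`hasExhaustiveCharts_transportDecomposition`) and `IsFutureOriented` (chain rule + timecone lemma).
[cite: Ringstrom2009, Thm. 16.6] -/
theorem settlesT2_of_isMaximal (𝒟 : VacuumCauchyDevelopment trivialData) (hmax : 𝒟.IsMaximal) :
    SettlesT2 𝒟 := by
  have h := Minkowski.isIsometricTo_vacuumCauchyDevelopment_of_isMaximal hmax
  obtain ⟨hI, O, d, hsub, hO, hrays, hex, hfo⟩ := settlesT2_minkowski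
  refine ⟨(hasCompleteNullInfinity_iff_of_isIsometricTo _ _ h).1 hI, ?_⟩
  obtain ⟨ψ, hiso, hτ, hι⟩ := h
  refine ⟨ψ '' O, transportDecomposition (𝓢₁ := vacuumCauchyDevelopment.toSpacetime)
      (𝓢₂ := 𝒟.toSpacetime) ψ hiso hτ d, hsub, ?_, ?_,
    hasExhaustiveCharts_transportDecomposition _ hiso hτ d hex,
    isFutureOriented_transport _ hiso hτ d hfo⟩
  · rw [charted_transportDecomposition, ← image_exteriorOf ψ hiso hτ hι, ← hO]
  · exact stub_raysStayInClosure_transport _ trivialData vacuumCauchyDevelopment 𝒟 ψ hiso hτ hι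
      (fun p γ dom ↦ stub_rayTransport _ trivialData vacuumCauchyDevelopment 𝒟 ψ hiso hτ hι p γ dom)
      O hrays

/-! ### The two registered stubs -/

/-- **THE BODY OF THE CRUX `ChannelsResolveTameDevelopmentsR` AT `X = ℝ³`, `D = trivialData` HOLDS FOR
EVERY MGHD**, unconditionally (registered stub `channelsResolveTameDevelopmentsR_trivialData`, seat 0):
for every maximal vacuum Cauchy development `𝒟` of the trivial datum, the honest sub-extremal `C²`
decomposition of the self-determined exterior with rays staying, exhaustive future-oriented charts
exists — from `settlesT2_of_isMaximal`; the hypotheses complete `𝓘⁺`, (i) no extremal late chart and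
(ii) tame outer region are idle. So a refutation of the crux needs a non-flat admissible datum.
[cite: DafermosLuk2017, Conjecture 1] -/
theorem channelsResolveTameDevelopmentsR_trivialData : ∀ 𝒟 : VacuumCauchyDevelopment trivialData, 𝒟.IsMaximal → _root_.Summit.FinalStateConjecture.HasCompleteNullInfinity 𝒟.toCauchyDevelopment → ((∀ (Λ : lorentzGroup) (c : E4) (M a : ℝ), Kerr.IsExtremal M a → ¬ ∃ (τ₀ : ℝ) (Ψ : (boostedKerrBackground Λ c M a).domain → 𝒟.carrier), 𝒟.toSpacetime.IsLateChart (boostedKerrBackground Λ c M a) Set.univ τ₀ Ψ ∧ ∀ R : ℝ, Tendsto (fun τ => 𝒟.toSpacetime.truncDeviationCk (boostedKerrBackground Λ c M a) Ψ 2 R τ) atTop (𝓝 0)) ∧ ∀ [𝒟.metric.HasLeviCivita], let outer : Set 𝒟.carrier := 𝒟.metric.causalFuture 𝒟.timeOrientation (Set.range 𝒟.embed) ∩ {q | ∃ (p : slice) (γ : ℝ → 𝒟.carrier) (dom : Set ℝ), 𝒟.metric.IsNormalisedNullRayFrom 𝒟.timeOrientation 𝒟.embed 𝒟.normal p γ dom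 ∧ ¬ BddAbove dom ∧ q ∈ 𝒟.metric.chronologicalPast 𝒟.timeOrientation (γ '' (dom ∩ Set.Ici 0))}
    ∃ r₀ : ℝ, 0 < r₀ ∧ ∃ Λ : NNReal, ∀ q ∈ outer, let U : TopologicalSpace.Opens E4 := ⟨Metric.ball (0 : E4) r₀, Metric.isOpen_ball⟩
    ∃ Ψ : U → 𝒟.carrier, 𝒟.toSpacetime.IsLateChart (Minkowski.backgroundOn U) Set.univ (-r₀) Ψ ∧ (∃ x : U, (x : E4) = 0 ∧ Ψ x = q) ∧ supCkENorm (U : Set E4) 3 (𝒟.toSpacetime.deviationExtend (Minkowski.backgroundOn U) Ψ) ≤ (Λ : ENNReal) ∧ supCkENorm (U : Set E4) 0 (𝒟.toSpacetime.deviationExtend (Minkowski.backgroundOn U) Ψ) ≤ 1 / 2) → ∃ (O : Set 𝒟.carrier) (d : FinalStateDecomposition 𝒟.toSpacetime O 2), O = _root_.Summit.FinalStateConjecture.exteriorOf 𝒟.toCauchyDevelopment d.charted ∧ _root_.Summit.FinalStateConjecture.RaysStayInClosure 𝒟.toCauchyDevelopment O ∧ _root_.Summit.FinalStateConjecture.HasExhaustiveCharts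 d ∧ _root_.Summit.FinalStateConjecture.IsFutureOriented d := by
  intro 𝒟 hmax _ _
  obtain ⟨-, O, d, -, hO, hrays, hex, hfo⟩ := settlesT2_of_isMaximal 𝒟 hmax
  exact ⟨O, d, hO, hrays, hex, hfo⟩

/-- **THE SUMMIT'S BUNDLED PER-DATUM PROPERTY HOLDS AT THE TRIVIAL DATUM** (registered stub
`summitProperty_trivialData`, seat 0): given the Choquet-Bruhat–Geroch existence theorem, Minkowski space is
an MGHD of `(ℝ³, δ, 0)` (`Minkowski.isMaximal_vacuumCauchyDevelopment`), and — unconditionally — EVERY MGHD of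
the trivial datum has complete `𝓘⁺` and an honest sub-extremal `C²` final-state decomposition of its
self-determined exterior with rays staying, exhaustive and future-oriented charts (`settlesT2_of_isMaximal`).
[cite: ChoquetBruhatGeroch1969CMP, Thm. 3] -/
theorem summitProperty_trivialData (hcbg : choquetBruhat_geroch_exists_mghd_cauchy) : (∃ 𝒟 : VacuumCauchyDevelopment trivialData, 𝒟.IsMaximal) ∧ ∀ 𝒟 : VacuumCauchyDevelopment trivialData, 𝒟.IsMaximal → _root_.Summit.FinalStateConjecture.HasCompleteNullInfinity 𝒟.toCauchyDevelopment ∧ ∃ (O : Set 𝒟.carrier) (d : FinalStateDecomposition 𝒟.toSpacetime O 2), (∀ i, Kerr.IsSubextremal (d.mass i) (d.spin i)) ∧ O = _root_.Summit.FinalStateConjecture.exteriorOf 𝒟.toCauchyDevelopment d.charted ∧ _root_.Summit.FinalStateConjecture.RaysStayInClosure 𝒟.toCauchyDevelopment O ∧ _root_.Summit.FinalStateConjecture.HasExhaustiveCharts d ∧ _root_.Summit.FinalStateConjecture.IsFutureOriented d :=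
  ⟨⟨vacuumCauchyDevelopment, Minkowski.isMaximal_vacuumCauchyDevelopment hcbg⟩,
    fun 𝒟 hmax ↦ settlesT2_of_isMaximal 𝒟 hmax⟩

end Summit.FinalStateConjecture.FinalStateConjecture.Theorems.ChannelsResolveTameDevelopmentsR.TrivialDatum

end
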